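import Summits.BirchSwinnertonDyer.BirchSwinnertonDyer.Theorems.ManinLocalTwoThreeStevensCurveOfCuspZero
import Summits.BirchSwinnertonDyer.BirchSwinnertonDyer.Theorems.ManinLocalTwoThreeShimuraKernelCuspZeroOrder
import Summits.BirchSwinnertonDyer.BirchSwinnertonDyer.Theorems.ManinLocalTwoThreeCuspLiftingHolds
import HarnessLib

/-!
# ODD ANALYTIC RANK ⟹ THE SHIMURA KERNEL IS TRIVIAL — LEAD's «Stevens' curve = the optimal curve when `φ₀(0) = O`» package, now UNCONDITIONAL
(route `ManinLocalTwoThree`, cruxes C2 `ManinOddAtFour` stmt-BirchSwinnertonDyer-22967 / C3 stmt-…-22968; cell bsd-f2-manin, prover seat p3 gen 21;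
`--supports stmt-BirchSwinnertonDyer-22967`)

LEAD p1 g18's `…StevensCurveOfCuspZero` (`SigmaHabitat.*_of_print`) and `…ShimuraKernelCuspZeroOrder` derived, MODULO the printed facts F★, F♮, CES,
that `{∞,0}_f ∈ Λ₀(f)` forces `Λ₁(f) = Λ₀(f)` (Θ at `m = 1`), hence `|c₀| = |c₁|`, and that at `4 ∣ N` (resp. `9 ∣ N`) a non-trivial Shimura
kernel forces the cuspidal point `φ₀(0)` to have EVEN order (resp. order divisible by `3`) — so the C2/C3 obstructions live in analytic rank `0`.
With Θ now an unconditional theorem for EVERY `X₀(N)`-datum (`CuspLifting.cuspZeroAnnihilates`, p768114: F★₀/F★/F♮ are tree theorems and p2's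
lattice-clause-free Stevens twin replaces CES), the whole package holds UNCONDITIONALLY and — for the lattice statements — for EVERY `X₀(N)`-datum
(no lattice clause, no global minimality):

* §1 `periodLatticeGamma1_eq_of_modularSymbol_zero_mem` (`{∞,0}_f ∈ Λ₀(f) ⟹ Λ₁(f) = Λ₀(f)`), `…_of_modularSymbol_zero_eq_zero`,
  `…_of_isFrickeEigen_one` (`w_N f = f`), `…_of_frickeEigenvalue_eq_one`, **`…_of_rootNumber_eq_neg_one`** (root number `−1`, conductor level).
* §2 `natAbs_maninConstant₀_eq_of_modularSymbol_zero_mem` / **`natAbs_maninConstant₀_eq_of_rootNumber_eq_neg_one`**: `|c₀| = |c₁|` for the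
  lattice-optimal `X₀`-datum and Stevens' optimal `X₁`-datum of isogenous minimal curves, on the locus `φ₀(0) = O` ⊇ {root number `−1`}.
* §3 `periodLatticeGamma1_eq_of_natMul_mem_of_coprime_cuspZero` (coprime annihilators collapse the quotient),
  `even_of_natMul_modularSymbol_zero_mem_of_ne_of_four_dvd` (`4 ∣ N`, `Λ₁ ≠ Λ₀` ⟹ `ord φ₀(0)` even),
  `three_dvd_of_natMul_modularSymbol_zero_mem_of_ne_of_nine_dvd` (`9 ∣ N`, `Λ₁ ≠ Λ₀` ⟹ `3 ∣ ord φ₀(0)`),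
  `modularSymbol_zero_not_mem_of_ne` (`Λ₁ ≠ Λ₀ ⟹ {∞,0}_f ∉ Λ₀(f)`, i.e. `L(f,1) ≠ 0`).

HONEST FRAMING: unconditional, fact-free, standard axioms; every proof is LEAD's with the three fact binders replaced by the tree theorem Θ.
Which root-number-`+1` curves have `Λ₁ ≠ Λ₀` is NOT decided; C2, C3, Stevens' conjecture, Manin's conjecture and BSD are NOT proved.  No definitions,
no sorry.  NEAREST PRINT (LEAD's presearch 2026-08-29): Stevens 1989 §2 / Vatsal 2005 Rem. 1.8 (constant kernel of `E₁ → E₀`); the root-number /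
`φ₀(0) = O` formulation is not stated there.
[cite: Stevens1982, Thm. 1.3.1] [cite: Stevens1989, Thm. 1.9 and §2] [cite: Vatsal2005, Rem. 1.8] [cite: AtkinLehner1970, Thm. 3]
[cite: Manin1972, Thm. 3.5 / Cor. 3.6] [cite: LingOesterle1991, Thm. 6]
-/

set_option autoImplicit false
-- lint-debt: the directory name repeats the summit name (sibling precedent `ManinLocalTwoThreeStevensCurveOfCuspZero.lean`)
set_option linter.dupNamespace false

noncomputable section

open scoped MatrixGroups ModularForm
open CongruenceSubgroup Complex
open WeierstrassCurve Literature.NumberTheory.EllipticCurves Literature.NumberTheory.EllipticCurves.ModularForms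
open Summit.BirchSwinnertonDyer.BirchSwinnertonDyer.Theorems.ManinLocalTwoThree.SigmaHabitat

namespace Summit.BirchSwinnertonDyer.BirchSwinnertonDyer.Theorems.ManinLocalTwoThree.CuspLifting

variable {W W₁ : WeierstrassCurve ℚ} [W.IsElliptic] {N : ℕ} [NeZero N]

/-! ## §1 `φ₀(0) = O` ⟹ `Λ₁(f) = Λ₀(f)` — for EVERY `X₀(N)`-datum -/

/-- **`{∞,0}_f ∈ Λ₀(f) ⟹ Λ₁(f) = Λ₀(f)`** for every `X₀(N)`-datum (Θ at `m = 1`; unconditional). [cite: Stevens1989, §2] [cite: Vatsal2005, Rem. 1.8] -/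
theorem periodLatticeGamma1_eq_of_modularSymbol_zero_mem (D : ModularParametrizationData W N)
    (h0 : modularSymbol D.f 0 ∈ periodLattice D.f) : periodLatticeGamma1 D.f = periodLattice D.f := by
  refine le_antisymm (periodLatticeGamma1_le_periodLattice D.f) fun x hx ↦ ?_
  have h := cuspZeroAnnihilates D 1 (by simpa using h0) x hx
  simpa using h

/-- **`{∞,0}_f = 0` (e.g. `L(f,1) = 0`) ⟹ `Λ₁(f) = Λ₀(f)`** (unconditional). [cite: Stevens1989, §2] -/
theorem periodLatticeGamma1_eq_of_modularSymbol_zero_eq_zero (D : ModularParametrizationData W N)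
    (h0 : modularSymbol D.f 0 = 0) : periodLatticeGamma1 D.f = periodLattice D.f :=
  periodLatticeGamma1_eq_of_modularSymbol_zero_mem D (by rw [h0]; exact zero_mem _)

/-- **`w_N f = +f` ⟹ `Λ₁(f) = Λ₀(f)`** (unconditional): `2·{∞,0}_f = 0` by the Fricke flip. [cite: AtkinLehner1970, Thm. 3] -/
theorem periodLatticeGamma1_eq_of_isFrickeEigen_one (D : ModularParametrizationData W N) (hW : IsFrickeEigen N D.f 1) :
    periodLatticeGamma1 D.f = periodLattice D.f := by
  refine periodLatticeGamma1_eq_of_modularSymbol_zero_eq_zero D ?_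
  have h := one_add_mul_modularSymbol_zero_eq_zero D.f hW (by norm_num)
  have h2 : (2 : ℂ) * modularSymbol D.f 0 = 0 := by rw [← h]; ring
  exact (mul_eq_zero.mp h2).resolve_left two_ne_zero

/-- **`frickeEigenvalue f = +1` ⟹ `Λ₁(f) = Λ₀(f)`** (unconditional). [cite: AtkinLehner1970, Thm. 3] -/
theorem periodLatticeGamma1_eq_of_frickeEigenvalue_eq_one (D : ModularParametrizationData W N) (hε : frickeEigenvalue D.f = 1) :
    periodLatticeGamma1 D.f = periodLattice D.f := by
  have hW := isFrickeEigen_frickeEigenvalue D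
  rw [hε] at hW
  exact periodLatticeGamma1_eq_of_isFrickeEigen_one D hW

/-- **ROOT NUMBER `−1` ⟹ STEVENS' CURVE = THE OPTIMAL CURVE, UNCONDITIONALLY**: for every `X₀(N_W)`-datum of an elliptic `W/ℚ` with `w(W) = −1`
(odd analytic rank), `Λ₁(f) = Λ₀(f)`. [cite: AtkinLehner1970, Thm. 3] [cite: Stevens1989, §2] -/
theorem periodLatticeGamma1_eq_of_rootNumber_eq_neg_one [W.IsGloballyMinimal] [NeZero (W.conductorNorm ℤ)]
    (D : ModularParametrizationData W (W.conductorNorm ℤ)) (hw : W.rootNumber = -1) :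
    periodLatticeGamma1 D.f = periodLattice D.f := by
  have hW := D.isNewformOf.isFrickeEigen_neg_rootNumber
  rw [hw] at hW
  norm_num at hW
  exact periodLatticeGamma1_eq_of_isFrickeEigen_one D hW

/-! ## §2 `|c₀| = |c₁|` on the locus `φ₀(0) = O` (E-an-151 there), unconditionally -/

/-- **`|c₀| = |c₁|` when the cusp `0` maps to the origin** (lattice-optimal `D₀` of minimal `W`, optimal `X₁(N)`-datum `D₁` of an isogenous minimal
`W₁`; unconditional). [cite: Stevens1989, §2] -/
theorem natAbs_maninConstant₀_eq_of_modularSymbol_zero_mem [W.IsGloballyMinimal] [W₁.IsElliptic] [W₁.IsGloballyMinimal]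
    (D₁ : Gamma1ParametrizationData W₁ N) (D₀ : ModularParametrizationData W N)
    (hiso : IsIsogenous W₁ W) (h₁ : D₁.IsOptimal) (h₀ : ∀ z ∈ D₀.L.lattice, ∃ w ∈ periodLattice D₀.f, z = D₀.c * w)
    (h0 : modularSymbol D₀.f 0 ∈ periodLattice D₀.f) : D₀.maninConstant.natAbs = D₁.maninConstant.natAbs :=
  natAbs_maninConstant₀_eq_of_periodLatticeGamma1_eq_periodLattice D₁ D₀ h₁ h₀ (D₁.f_eq_of_isIsogenous D₀ hiso)
    (periodLatticeGamma1_eq_of_modularSymbol_zero_mem D₀ h0)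

/-- **`|c₀| = |c₁|` for every optimal curve of ROOT NUMBER `−1`, UNCONDITIONALLY** (conductor level) — E-an-151 `GammaOneTransferAtFour` and its
`p = 3` twin hold on the odd-analytic-rank half with no further input. [cite: Stevens1989, §2] [cite: AtkinLehner1970, Thm. 3] -/
theorem natAbs_maninConstant₀_eq_of_rootNumber_eq_neg_one [W.IsGloballyMinimal] [W₁.IsElliptic] [W₁.IsGloballyMinimal]
    [NeZero (W.conductorNorm ℤ)] (D₁ : Gamma1ParametrizationData W₁ (W.conductorNorm ℤ))
    (D₀ : ModularParametrizationData W (W.conductorNorm ℤ)) (hiso : IsIsogenous W₁ W) (h₁ : D₁.IsOptimal)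
    (h₀ : ∀ z ∈ D₀.L.lattice, ∃ w ∈ periodLattice D₀.f, z = D₀.c * w) (hw : W.rootNumber = -1) :
    D₀.maninConstant.natAbs = D₁.maninConstant.natAbs :=
  natAbs_maninConstant₀_eq_of_periodLatticeGamma1_eq_periodLattice D₁ D₀ h₁ h₀ (D₁.f_eq_of_isIsogenous D₀ hiso)
    (periodLatticeGamma1_eq_of_rootNumber_eq_neg_one D₀ hw)

/-! ## §3 A Shimura `p`-kernel needs `p ∣ ord φ₀(0)` — for EVERY `X₀(N)`-datum, unconditionally -/

/-- **Coprime annihilators collapse the quotient** (unconditional): if `p·Λ₀ ⊆ Λ₁` and `m·{∞,0}_f ∈ Λ₀(f)` with `gcd(p, m) = 1`, then `Λ₁(f) = Λ₀(f)`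
(Θ gives `m·Λ₀ ⊆ Λ₁`; Bézout). [cite: Stevens1982, Thm. 1.3.1] [cite: LingOesterle1991, Thm. 6] -/
theorem periodLatticeGamma1_eq_of_natMul_mem_of_coprime_cuspZero (D : ModularParametrizationData W N)
    {p m : ℕ} (hp : ∀ z ∈ periodLattice D.f, (p : ℂ) * z ∈ periodLatticeGamma1 D.f)
    (hm : (m : ℂ) * modularSymbol D.f 0 ∈ periodLattice D.f) (hcop : Nat.Coprime p m) :
    periodLatticeGamma1 D.f = periodLattice D.f := by
  refine le_antisymm (periodLatticeGamma1_le_periodLattice D.f) fun z hz ↦ ?_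
  have hΘ := cuspZeroAnnihilates D m hm z hz
  obtain ⟨α, β, hαβ⟩ := Nat.isCoprime_iff_coprime.mpr hcop
  have h1 : (α : ℂ) * (p : ℂ) + (β : ℂ) * (m : ℂ) = 1 := by exact_mod_cast hαβ
  have key : z = (α : ℂ) * ((p : ℂ) * z) + (β : ℂ) * ((m : ℂ) * z) := by linear_combination -z * h1
  rw [key]
  have ha := (periodLatticeGamma1 D.f).zsmul_mem (hp z hz) α
  have hb := (periodLatticeGamma1 D.f).zsmul_mem hΘ β
  rw [zsmul_eq_mul] at ha hb
  exact add_mem ha hb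

/-- **At `4 ∣ N`: `Λ₁(f) ≠ Λ₀(f)` ⟹ every `m` with `m·{∞,0}_f ∈ Λ₀(f)` is EVEN** — the cuspidal point `φ₀(0)` has even order (unconditional).
So the Shimura `2`-kernel of C2 lives only on analytic-rank-`0` classes with a rational point of even order. [cite: LingOesterle1991, Thm. 6] -/
theorem even_of_natMul_modularSymbol_zero_mem_of_ne_of_four_dvd (D : ModularParametrizationData W N) (h4 : 2 ^ 2 ∣ N)
    (hne : periodLatticeGamma1 D.f ≠ periodLattice D.f) {m : ℕ} (hm : (m : ℂ) * modularSymbol D.f 0 ∈ periodLattice D.f) : Even m := by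
  by_contra hodd
  rw [Nat.not_even_iff_odd] at hodd
  exact hne (periodLatticeGamma1_eq_of_natMul_mem_of_coprime_cuspZero D
    (fun z hz ↦ by exact_mod_cast two_mul_mem_periodLatticeGamma1_of_four_dvd D h4 hz) hm
    (Nat.coprime_two_left.mpr hodd))

/-- **At `9 ∣ N`: `Λ₁(f) ≠ Λ₀(f)` ⟹ every `m` with `m·{∞,0}_f ∈ Λ₀(f)` is divisible by `3`** (unconditional): the Shimura `3`-kernel of C3 lives only on
analytic-rank-`0` classes with a rational point of order divisible by `3`. [cite: LingOesterle1991, Thm. 6] -/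
theorem three_dvd_of_natMul_modularSymbol_zero_mem_of_ne_of_nine_dvd (D : ModularParametrizationData W N) (h9 : 3 ^ 2 ∣ N)
    (hne : periodLatticeGamma1 D.f ≠ periodLattice D.f) {m : ℕ} (hm : (m : ℂ) * modularSymbol D.f 0 ∈ periodLattice D.f) : 3 ∣ m := by
  by_contra h3
  exact hne (periodLatticeGamma1_eq_of_natMul_mem_of_coprime_cuspZero D
    (fun z hz ↦ by exact_mod_cast three_mul_mem_periodLatticeGamma1_of_nine_dvd D h9 hz) hm
    ((Nat.Prime.coprime_iff_not_dvd Nat.prime_three).mpr h3))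

/-- **`Λ₁(f) ≠ Λ₀(f)` ⟹ `{∞,0}_f ∉ Λ₀(f)`** (so `{∞,0}_f ≠ 0`, `L(f,1) ≠ 0`: analytic rank `0`; unconditional, every `X₀(N)`-datum). -/
theorem modularSymbol_zero_not_mem_of_ne (D : ModularParametrizationData W N)
    (hne : periodLatticeGamma1 D.f ≠ periodLattice D.f) : modularSymbol D.f 0 ∉ periodLattice D.f :=
  fun h0 ↦ hne (periodLatticeGamma1_eq_of_modularSymbol_zero_mem D h0)

/-- **`Λ₁(f) ≠ Λ₀(f)` ⟹ `{∞,0}_f ≠ 0`** (unconditional). -/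
theorem modularSymbol_zero_ne_zero_of_ne (D : ModularParametrizationData W N)
    (hne : periodLatticeGamma1 D.f ≠ periodLattice D.f) : modularSymbol D.f 0 ≠ 0 :=
  fun h0 ↦ hne (periodLatticeGamma1_eq_of_modularSymbol_zero_eq_zero D h0)

/-- **A non-trivial Shimura kernel forces ROOT NUMBER `+1`** (conductor level, unconditional): contrapositive of §1. [cite: AtkinLehner1970, Thm. 3] -/
theorem rootNumber_eq_one_of_ne [W.IsGloballyMinimal] [NeZero (W.conductorNorm ℤ)]
    (D : ModularParametrizationData W (W.conductorNorm ℤ)) (hne : periodLatticeGamma1 D.f ≠ periodLattice D.f) : W.rootNumber = 1 := by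
  rcases W.rootNumber_eq_one_or with h | h
  · exact h
  · exact (hne (periodLatticeGamma1_eq_of_rootNumber_eq_neg_one D h)).elim

end Summit.BirchSwinnertonDyer.BirchSwinnertonDyer.Theorems.ManinLocalTwoThree.CuspLifting

end
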